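import Summits.QuantumFields.YangMills.Theorems.WeakCouplingRatesColdBoxDirichletPosDef

/-!
# LINE-18 v5 (crux `AllWindowsColdBox.BulkMidWindowSU2`, ⟨stmt-QuantumFields-24006⟩), toward stub K3′ `stub_harmonicMaxPrincipleFlux`:
# collar geometry of the temporal-gauge Dirichlet problem — what the typed hypothesis of K3′ pins

The hypothesis of the registered obligation K3′ `DirHarmonicMaxPrincipleFlux` bounds `(sCirc (glue ϑ 0) q)² ≤ B` for EVERY plaquette key
`q : Plaq 4` whose four edges lie outside `dirFreeEdges H`.  Besides the genuine collar plaquettes of the enlarged vertex box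
`Λ⁺ = {−1,…,2H+1}⁴` this includes the keys STRADDLING the outer boundary of `Λ⁺`: for an edge `e = (y, m)` of `Λ⁺` running inside an outer
layer `{y_k = −1}` or `{y_k = 2H+1}` (`k ≠ m`), the key `(y, k, m)` resp. `(y − e_k, k, m)` has three edges outside `Λ⁺` (where `glue` is `0`), so
its circulation is the single value `∓ϑ e`.  Consequences recorded here (all elementary coordinate bookkeeping over the tree's `LatticeMaxwell.glue`
/ `boxEdgesAt` / `dirFreeEdges`):

* `mem_dirBlock_iff`, `mem_coldBoxEdges_iff` — coordinate descriptions of the edges of `Λ⁺` and of the cold box `Λ = {0,…,2H}⁴`;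
* `dirGlue0_*` — the values of `glue ϑ 0` (datum on pinned edges of `Λ⁺`, `0` on free edges and off `Λ⁺`);
* `abs_theta_shell_le` — **shell values are pinned**: `|ϑ (y, m)| ≤ √B` for every edge of `Λ⁺` inside an outer layer;
* `abs_theta_top_sub_top_le`, `abs_theta_top_add_bot_le`, `abs_theta_bot_sub_bot_le` — the corner plaquettes spanned by two NORMAL links at a
  boundary vertex of `Λ` (both outward, outward/inward, both inward) are fully pinned, so any two normal values at the same vertex agree up to
  `3√B` (with the sign dictated by the orientation).

No definition, standard axioms.  HONEST LABEL: helper toward ONE registered stub of a critic-passed line on the R2ξ″ RECORD-rung crux 24006; no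
stub, crux, rung or summit is proved here; the Yang–Mills mass gap is NOT proved by this file.
-/

set_option autoImplicit false

noncomputable section

open Finset
open Literature.Probability.LatticeModels (Site halfOpenBox mem_halfOpenBox)
open Literature.MathematicalPhysics.QuantumFieldTheory
open Literature.MathematicalPhysics.QuantumFieldTheory.LatticeMaxwell
open Literature.MathematicalPhysics.QuantumFieldTheory.AxialGauge
open Summit.QuantumFields.YangMills.Theorems.WeakCouplingRates

namespace Summit.QuantumFields.YangMills.Theorems.AllWindowsColdBoxBulkMidLine

variable {H : ℕ}

/-! ## Coordinates -/

/-- Edges of the enlarged vertex box `Λ⁺ = {−1,…,2H+1}⁴`: all coordinates of the base point in `[−1, 2H+1]`, the far endpoint too. -/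
theorem mem_dirBlock_iff {x : Site 4} {i : Fin 4} :
    (x, i) ∈ boxEdgesAt dirCorner (2 * H + 3) ↔ (∀ k, -1 ≤ x k ∧ x k ≤ 2 * (H : ℤ) + 1) ∧ x i ≤ 2 * (H : ℤ) := by
  rw [mem_boxEdgesAt, mem_boxEdges_iff]
  simp only [Pi.sub_apply, dirCorner]
  push_cast
  constructor
  · rintro ⟨h1, h2⟩
    exact ⟨fun k => by have := h1 k; omega, by omega⟩
  · rintro ⟨h1, h2⟩
    exact ⟨fun k => by have := h1 k; omega, by omega⟩

/-- Edges of the cold box `Λ = {0,…,2H}⁴`. -/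
theorem mem_coldBoxEdges_iff {x : Site 4} {i : Fin 4} :
    (x, i) ∈ boxEdges 4 (2 * H + 1) ↔ (∀ k, 0 ≤ x k ∧ x k ≤ 2 * (H : ℤ)) ∧ x i ≤ 2 * (H : ℤ) - 1 := by
  rw [mem_boxEdges_iff]
  push_cast
  constructor
  · rintro ⟨h1, h2⟩
    exact ⟨fun k => by have := h1 k; omega, by omega⟩
  · rintro ⟨h1, h2⟩
    exact ⟨fun k => by have := h1 k; omega, by omega⟩

/-- Cold-box edges are edges of the enlarged box. -/
theorem mem_dirBlock_of_mem_coldBoxEdges {x : Site 4} {i : Fin 4} (h : (x, i) ∈ boxEdges 4 (2 * H + 1)) :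
    (x, i) ∈ boxEdgesAt dirCorner (2 * H + 3) := by
  rw [mem_coldBoxEdges_iff] at h
  rw [mem_dirBlock_iff]
  exact ⟨fun k => by have := h.1 k; omega, by have := h.2; omega⟩

/-- Free Dirichlet edges are cold-box edges. -/
theorem not_mem_dirFreeEdges_of_not_mem {e : Literature.MathematicalPhysics.QuantumLattice.ZdEdge 4}
    (h : e ∉ boxEdges 4 (2 * H + 1)) : e ∉ dirFreeEdges H := fun hf => h (mem_dirFreeEdges.1 hf).1

/-- An edge whose base point has a coordinate outside `[−1, 2H+1]` is not an edge of the enlarged box. -/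
theorem not_mem_dirBlock_of_fst {x : Site 4} {i : Fin 4} (hx : ∃ k, x k < -1 ∨ 2 * (H : ℤ) + 1 < x k) :
    (x, i) ∉ boxEdgesAt dirCorner (2 * H + 3) := by
  rw [mem_dirBlock_iff]
  rintro ⟨h1, -⟩
  obtain ⟨k, hk⟩ := hx
  have := h1 k
  omega

/-- An edge whose far endpoint leaves the enlarged box in its own direction is not an edge of the enlarged box. -/
theorem not_mem_dirBlock_of_dir {x : Site 4} {i : Fin 4} (hx : 2 * (H : ℤ) < x i) :
    (x, i) ∉ boxEdgesAt dirCorner (2 * H + 3) := by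
  rw [mem_dirBlock_iff]
  rintro ⟨-, h2⟩
  omega

/-! ## Values of the datum-only glued field `glue ϑ 0` -/

variable (ϑ : Literature.MathematicalPhysics.QuantumLattice.ZdEdge 4 → ℝ)

/-- On a pinned edge of the enlarged box (not a cold-box edge) `glue ϑ 0` is the datum. -/
theorem dirGlue0_of_not_mem_coldBox {x : Site 4} {i : Fin 4} (hb : (x, i) ∈ boxEdgesAt dirCorner (2 * H + 3))
    (hne : (x, i) ∉ boxEdges 4 (2 * H + 1)) :
    LatticeMaxwell.glue (pin := fun e => e ∉ dirFreeEdges H) dirCorner (2 * H + 3) ϑ 0 (x, i) = ϑ (x, i) :=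
  glue_apply_pin ϑ 0 hb (not_mem_dirFreeEdges_of_not_mem hne)

/-- Off the enlarged box `glue ϑ 0` vanishes. -/
theorem dirGlue0_of_not_mem_dirBlock {x : Site 4} {i : Fin 4} (hb : (x, i) ∉ boxEdgesAt dirCorner (2 * H + 3)) :
    LatticeMaxwell.glue (pin := fun e => e ∉ dirFreeEdges H) dirCorner (2 * H + 3) ϑ 0 (x, i) = 0 :=
  glue_apply_of_not_mem ϑ 0 hb

/-- On a free Dirichlet edge `glue ϑ 0` vanishes. -/
theorem dirGlue0_of_mem_dirFreeEdges {x : Site 4} {i : Fin 4} (hf : (x, i) ∈ dirFreeEdges H) :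
    LatticeMaxwell.glue (pin := fun e => e ∉ dirFreeEdges H) dirCorner (2 * H + 3) ϑ 0 (x, i) = 0 := by
  have hb : (x, i) ∈ boxEdgesAt dirCorner (2 * H + 3) := mem_dirBlock_of_mem_coldBoxEdges (mem_dirFreeEdges.1 hf).1
  have h := glue_apply_free (pin := fun e => e ∉ dirFreeEdges H) ϑ (0 : DirFree H → ℝ) ⟨⟨(x, i), hb⟩, fun h => h hf⟩
  simpa using h

/-- On the temporal forest `glue ϑ 0` is the datum. -/
theorem dirGlue0_of_forest {x : Site 4} (hx : ∀ k : Fin 4, 1 ≤ x k ∧ x k + 1 ≤ 2 * (H : ℤ)) :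
    LatticeMaxwell.glue (pin := fun e => e ∉ dirFreeEdges H) dirCorner (2 * H + 3) ϑ 0 (x, 0) = ϑ (x, 0) := by
  have hb : (x, (0 : Fin 4)) ∈ boxEdgesAt dirCorner (2 * H + 3) := by
    rw [mem_dirBlock_iff]
    exact ⟨fun k => by have := hx k; omega, by have := hx 0; omega⟩
  exact glue_apply_pin ϑ 0 hb (fun hf => (mem_dirFreeEdges.1 hf).2 ⟨rfl, hx⟩)

/-! ## What the typed hypothesis pins: shell values and corner fluxes -/

section Hyp

variable {ϑ} {B : ℝ}
  (hB : ∀ q : Plaq 4, (q.1, q.2.1) ∉ dirFreeEdges H → (q.1 + Pi.single q.2.1 1, q.2.2) ∉ dirFreeEdges H →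
      (q.1 + Pi.single q.2.2 1, q.2.1) ∉ dirFreeEdges H → (q.1, q.2.2) ∉ dirFreeEdges H →
      (sCirc (LatticeMaxwell.glue (pin := fun e => e ∉ dirFreeEdges H) dirCorner (2 * H + 3) ϑ 0) q) ^ 2 ≤ B)
include hB

/-- `B` is non-negative (the far-away keys have circulation `0`), so `√B² = B`. -/
theorem hypB_nonneg_and_sq_sqrt : 0 ≤ B ∧ Real.sqrt B ^ 2 = B := by
  suffices h0B : 0 ≤ B from ⟨h0B, Real.sq_sqrt h0B⟩
  set y : Site 4 := fun _ => 2 * (H : ℤ) + 5 with hy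
  have hfar : ∀ (z : Site 4) (i : Fin 4), (∀ k, 2 * (H : ℤ) + 5 ≤ z k) →
      (z, i) ∉ boxEdgesAt dirCorner (2 * H + 3) := fun z i hz =>
    not_mem_dirBlock_of_fst ⟨i, Or.inr (by have := hz i; omega)⟩
  have hfarE : ∀ (z : Site 4) (i : Fin 4), (∀ k, 2 * (H : ℤ) + 5 ≤ z k) → (z, i) ∉ dirFreeEdges H := fun z i hz hf =>
    hfar z i hz (mem_dirBlock_of_mem_coldBoxEdges (mem_dirFreeEdges.1 hf).1)
  have hy0 : ∀ k, 2 * (H : ℤ) + 5 ≤ y k := fun k => by simp [hy]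
  have hy1 : ∀ (j : Fin 4) k, 2 * (H : ℤ) + 5 ≤ (y + Pi.single j (1 : ℤ) : Site 4) k := fun j k => by
    simp only [hy, Pi.add_apply, Pi.single_apply]; split_ifs <;> omega
  have h := hB (y, 0, 1) (hfarE _ _ hy0) (hfarE _ _ (hy1 0)) (hfarE _ _ (hy1 1)) (hfarE _ _ hy0)
  have h0 : sCirc (LatticeMaxwell.glue (pin := fun e => e ∉ dirFreeEdges H) dirCorner (2 * H + 3) ϑ 0) (y, 0, 1) = 0 := by
    simp only [sCirc, dirGlue0_of_not_mem_dirBlock ϑ (hfar _ _ hy0), dirGlue0_of_not_mem_dirBlock ϑ (hfar _ _ (hy1 _))]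
    ring
  rw [h0] at h
  simpa using h

/-- **Shell values are pinned by the typed hypothesis.**  An edge `(y, m)` of the enlarged box lying inside an outer layer `{y_k = 2H+1}` or
`{y_k = −1}` (`k ≠ m`) has `|ϑ (y, m)| ≤ √B`: the key `(y, k, m)` resp. `(y − e_k, k, m)` has its other three edges outside the enlarged box. -/
theorem abs_theta_shell_le {y : Site 4} {m k : Fin 4} (hkm : k ≠ m) (hb : (y, m) ∈ boxEdgesAt dirCorner (2 * H + 3))
    (hk : y k = 2 * (H : ℤ) + 1 ∨ y k = -1) : |ϑ (y, m)| ≤ Real.sqrt B := by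
  have hmk : m ≠ k := fun h => hkm h.symm
  have hyb := mem_dirBlock_iff.1 hb
  apply Real.abs_le_sqrt
  rcases hk with hk | hk
  · -- the key `(y, k, m)`
    have hne4 : (y, m) ∉ boxEdges 4 (2 * H + 1) := not_mem_boxEdges_of_fst ⟨k, Or.inr (by omega)⟩
    have hnb1 : (y, k) ∉ boxEdgesAt dirCorner (2 * H + 3) := not_mem_dirBlock_of_dir (by omega)
    have hnb2 : (y + Pi.single k (1 : ℤ), m) ∉ boxEdgesAt dirCorner (2 * H + 3) :=
      not_mem_dirBlock_of_fst ⟨k, Or.inr (by rw [Pi.add_apply, Pi.single_eq_same]; omega)⟩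
    have hnb3 : (y + Pi.single m (1 : ℤ), k) ∉ boxEdgesAt dirCorner (2 * H + 3) :=
      not_mem_dirBlock_of_dir (by rw [Pi.add_apply, Pi.single_eq_of_ne hkm]; omega)
    have hne1 : (y, k) ∉ boxEdges 4 (2 * H + 1) := fun h => hnb1 (mem_dirBlock_of_mem_coldBoxEdges h)
    have hne2 : (y + Pi.single k (1 : ℤ), m) ∉ boxEdges 4 (2 * H + 1) := fun h => hnb2 (mem_dirBlock_of_mem_coldBoxEdges h)
    have hne3 : (y + Pi.single m (1 : ℤ), k) ∉ boxEdges 4 (2 * H + 1) := fun h => hnb3 (mem_dirBlock_of_mem_coldBoxEdges h)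
    have h := hB (y, k, m) (not_mem_dirFreeEdges_of_not_mem hne1) (not_mem_dirFreeEdges_of_not_mem hne2)
      (not_mem_dirFreeEdges_of_not_mem hne3) (not_mem_dirFreeEdges_of_not_mem hne4)
    have hval : sCirc (LatticeMaxwell.glue (pin := fun e => e ∉ dirFreeEdges H) dirCorner (2 * H + 3) ϑ 0) (y, k, m) = -ϑ (y, m) := by
      simp only [sCirc, dirGlue0_of_not_mem_dirBlock ϑ hnb1, dirGlue0_of_not_mem_dirBlock ϑ hnb2,
        dirGlue0_of_not_mem_dirBlock ϑ hnb3, dirGlue0_of_not_mem_coldBox ϑ hb hne4]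
      ring
    rw [hval] at h
    simpa using h
  · -- the key `(y − e_k, k, m)`
    have hne2 : (y, m) ∉ boxEdges 4 (2 * H + 1) := not_mem_boxEdges_of_fst ⟨k, Or.inl (by omega)⟩
    have hnb1 : (y - Pi.single k (1 : ℤ), k) ∉ boxEdgesAt dirCorner (2 * H + 3) :=
      not_mem_dirBlock_of_fst ⟨k, Or.inl (by rw [Pi.sub_apply, Pi.single_eq_same]; omega)⟩
    have hnb3 : (y - Pi.single k (1 : ℤ) + Pi.single m (1 : ℤ), k) ∉ boxEdgesAt dirCorner (2 * H + 3) :=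
      not_mem_dirBlock_of_fst ⟨k, Or.inl (by
        rw [Pi.add_apply, Pi.sub_apply, Pi.single_eq_same, Pi.single_eq_of_ne hkm]; omega)⟩
    have hnb4 : (y - Pi.single k (1 : ℤ), m) ∉ boxEdgesAt dirCorner (2 * H + 3) :=
      not_mem_dirBlock_of_fst ⟨k, Or.inl (by rw [Pi.sub_apply, Pi.single_eq_same]; omega)⟩
    have hne1 : (y - Pi.single k (1 : ℤ), k) ∉ boxEdges 4 (2 * H + 1) := fun h => hnb1 (mem_dirBlock_of_mem_coldBoxEdges h)
    have hne3 : (y - Pi.single k (1 : ℤ) + Pi.single m (1 : ℤ), k) ∉ boxEdges 4 (2 * H + 1) :=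
      fun h => hnb3 (mem_dirBlock_of_mem_coldBoxEdges h)
    have hne4 : (y - Pi.single k (1 : ℤ), m) ∉ boxEdges 4 (2 * H + 1) := fun h => hnb4 (mem_dirBlock_of_mem_coldBoxEdges h)
    have hne2' : (y - Pi.single k (1 : ℤ) + Pi.single k (1 : ℤ), m) ∉ dirFreeEdges H := by
      rw [sub_add_cancel]; exact not_mem_dirFreeEdges_of_not_mem hne2
    have h := hB (y - Pi.single k (1 : ℤ), k, m) (not_mem_dirFreeEdges_of_not_mem hne1) hne2'
      (not_mem_dirFreeEdges_of_not_mem hne3) (not_mem_dirFreeEdges_of_not_mem hne4)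
    have hval : sCirc (LatticeMaxwell.glue (pin := fun e => e ∉ dirFreeEdges H) dirCorner (2 * H + 3) ϑ 0)
        (y - Pi.single k (1 : ℤ), k, m) = ϑ (y, m) := by
      simp only [sCirc, sub_add_cancel, dirGlue0_of_not_mem_dirBlock ϑ hnb1, dirGlue0_of_not_mem_dirBlock ϑ hnb3,
        dirGlue0_of_not_mem_dirBlock ϑ hnb4, dirGlue0_of_not_mem_coldBox ϑ hb hne2]
      ring
    rw [hval] at h
    exact h

/-- **Two outward normals at a boundary vertex agree up to `3√B`**: for `v ∈ Λ` with `v_j = v_{j'} = 2H` (`j ≠ j'`),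
`|ϑ (v, j) − ϑ (v, j')| ≤ 3√B` — the corner key `(v, j, j')` is fully pinned and its two other edges are shell edges. -/
theorem abs_theta_top_sub_top_le {v : Site 4} (hv : ∀ k, 0 ≤ v k ∧ v k ≤ 2 * (H : ℤ)) {j j' : Fin 4} (hjj : j ≠ j')
    (hj : v j = 2 * (H : ℤ)) (hj' : v j' = 2 * (H : ℤ)) : |ϑ (v, j) - ϑ (v, j')| ≤ 3 * Real.sqrt B := by
  -- the four edges of the key `(v, j, j')`
  have hb1 : (v, j) ∈ boxEdgesAt dirCorner (2 * H + 3) :=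
    mem_dirBlock_iff.2 ⟨fun k => by have := hv k; omega, by omega⟩
  have hne1 : (v, j) ∉ boxEdges 4 (2 * H + 1) := by rw [mem_coldBoxEdges_iff]; rintro ⟨-, h⟩; omega
  have hb4 : (v, j') ∈ boxEdgesAt dirCorner (2 * H + 3) :=
    mem_dirBlock_iff.2 ⟨fun k => by have := hv k; omega, by omega⟩
  have hne4 : (v, j') ∉ boxEdges 4 (2 * H + 1) := by rw [mem_coldBoxEdges_iff]; rintro ⟨-, h⟩; omega
  have hc2 : ∀ k, (v + Pi.single j (1 : ℤ) : Site 4) k = if k = j then 2 * (H : ℤ) + 1 else v k := fun k => by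
    simp only [Pi.add_apply, Pi.single_apply]; split_ifs with h <;> simp [h, hj]
  have hc3 : ∀ k, (v + Pi.single j' (1 : ℤ) : Site 4) k = if k = j' then 2 * (H : ℤ) + 1 else v k := fun k => by
    simp only [Pi.add_apply, Pi.single_apply]; split_ifs with h <;> simp [h, hj']
  have hb2 : (v + Pi.single j (1 : ℤ), j') ∈ boxEdgesAt dirCorner (2 * H + 3) := by
    refine mem_dirBlock_iff.2 ⟨fun k => ?_, ?_⟩
    · rw [hc2]; have := hv k; split_ifs <;> omega
    · rw [hc2, if_neg hjj.symm]; omega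
  have hne2 : (v + Pi.single j (1 : ℤ), j') ∉ boxEdges 4 (2 * H + 1) :=
    not_mem_boxEdges_of_fst ⟨j, Or.inr (by rw [hc2, if_pos rfl]; omega)⟩
  have hb3 : (v + Pi.single j' (1 : ℤ), j) ∈ boxEdgesAt dirCorner (2 * H + 3) := by
    refine mem_dirBlock_iff.2 ⟨fun k => ?_, ?_⟩
    · rw [hc3]; have := hv k; split_ifs <;> omega
    · rw [hc3, if_neg hjj]; omega
  have hne3 : (v + Pi.single j' (1 : ℤ), j) ∉ boxEdges 4 (2 * H + 1) :=
    not_mem_boxEdges_of_fst ⟨j', Or.inr (by rw [hc3, if_pos rfl]; omega)⟩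
  -- the two shell values
  have hs2 : |ϑ (v + Pi.single j (1 : ℤ), j')| ≤ Real.sqrt B :=
    abs_theta_shell_le hB hjj hb2 (Or.inl (by rw [hc2, if_pos rfl]))
  have hs3 : |ϑ (v + Pi.single j' (1 : ℤ), j)| ≤ Real.sqrt B :=
    abs_theta_shell_le hB (Ne.symm hjj) hb3 (Or.inl (by rw [hc3, if_pos rfl]))
  -- the corner flux
  have h := hB (v, j, j') (not_mem_dirFreeEdges_of_not_mem hne1) (not_mem_dirFreeEdges_of_not_mem hne2)
    (not_mem_dirFreeEdges_of_not_mem hne3) (not_mem_dirFreeEdges_of_not_mem hne4)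
  have hval : sCirc (LatticeMaxwell.glue (pin := fun e => e ∉ dirFreeEdges H) dirCorner (2 * H + 3) ϑ 0) (v, j, j') =
      ϑ (v, j) + ϑ (v + Pi.single j (1 : ℤ), j') - ϑ (v + Pi.single j' (1 : ℤ), j) - ϑ (v, j') := by
    simp only [sCirc, dirGlue0_of_not_mem_coldBox ϑ hb1 hne1, dirGlue0_of_not_mem_coldBox ϑ hb2 hne2,
      dirGlue0_of_not_mem_coldBox ϑ hb3 hne3, dirGlue0_of_not_mem_coldBox ϑ hb4 hne4]
  rw [hval] at h
  have hflux := Real.abs_le_sqrt h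
  have key : ϑ (v, j) - ϑ (v, j') =
      (ϑ (v, j) + ϑ (v + Pi.single j (1 : ℤ), j') - ϑ (v + Pi.single j' (1 : ℤ), j) - ϑ (v, j')) -
        ϑ (v + Pi.single j (1 : ℤ), j') + ϑ (v + Pi.single j' (1 : ℤ), j) := by ring
  rw [key]
  refine (abs_add_le _ _).trans ?_
  refine (add_le_add (abs_sub _ _) le_rfl).trans ?_
  linarith

/-- **An outward and an inward normal at a boundary vertex agree (with a sign) up to `3√B`**: for `v ∈ Λ` with `v_j = 2H`, `v_{j'} = 0`
(`j ≠ j'`), `|ϑ (v, j) + ϑ (v − e_{j'}, j')| ≤ 3√B` — the key `(v − e_{j'}, j, j')` is fully pinned. -/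
theorem abs_theta_top_add_bot_le {v : Site 4} (hv : ∀ k, 0 ≤ v k ∧ v k ≤ 2 * (H : ℤ)) {j j' : Fin 4} (hjj : j ≠ j')
    (hj : v j = 2 * (H : ℤ)) (hj' : v j' = 0) :
    |ϑ (v, j) + ϑ (v - Pi.single j' (1 : ℤ), j')| ≤ 3 * Real.sqrt B := by
  set z : Site 4 := v - Pi.single j' (1 : ℤ) with hz
  have hcz : ∀ k, z k = if k = j' then -1 else v k := fun k => by
    simp only [hz, Pi.sub_apply, Pi.single_apply]; split_ifs with h <;> simp [h, hj']
  have hcw : ∀ k, (z + Pi.single j (1 : ℤ) : Site 4) k = if k = j' then -1 else if k = j then 2 * (H : ℤ) + 1 else v k := fun k => by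
    simp only [Pi.add_apply, hcz, Pi.single_apply]
    by_cases h1 : k = j' <;> by_cases h2 : k = j <;> simp [h1, h2, hj] <;> subst_vars <;> first | exact absurd rfl hjj | omega
  have hzj' : z + Pi.single j' (1 : ℤ) = v := by rw [hz, sub_add_cancel]
  -- edges of the key `(z, j, j')`
  have hb1 : (z, j) ∈ boxEdgesAt dirCorner (2 * H + 3) := by
    refine mem_dirBlock_iff.2 ⟨fun k => ?_, ?_⟩
    · rw [hcz]; have := hv k; split_ifs <;> omega
    · rw [hcz, if_neg hjj]; omega
  have hne1 : (z, j) ∉ boxEdges 4 (2 * H + 1) := not_mem_boxEdges_of_fst ⟨j', Or.inl (by rw [hcz, if_pos rfl]; omega)⟩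
  have hb2 : (z + Pi.single j (1 : ℤ), j') ∈ boxEdgesAt dirCorner (2 * H + 3) := by
    refine mem_dirBlock_iff.2 ⟨fun k => ?_, ?_⟩
    · rw [hcw]; have := hv k; split_ifs <;> omega
    · rw [hcw, if_pos rfl]; omega
  have hne2 : (z + Pi.single j (1 : ℤ), j') ∉ boxEdges 4 (2 * H + 1) :=
    not_mem_boxEdges_of_fst ⟨j', Or.inl (by rw [hcw, if_pos rfl]; omega)⟩
  have hb3 : (v, j) ∈ boxEdgesAt dirCorner (2 * H + 3) :=
    mem_dirBlock_iff.2 ⟨fun k => by have := hv k; omega, by omega⟩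
  have hne3 : (v, j) ∉ boxEdges 4 (2 * H + 1) := by rw [mem_coldBoxEdges_iff]; rintro ⟨-, h⟩; omega
  have hb4 : (z, j') ∈ boxEdgesAt dirCorner (2 * H + 3) := by
    refine mem_dirBlock_iff.2 ⟨fun k => ?_, ?_⟩
    · rw [hcz]; have := hv k; split_ifs <;> omega
    · rw [hcz, if_pos rfl]; omega
  have hne4 : (z, j') ∉ boxEdges 4 (2 * H + 1) := not_mem_boxEdges_of_fst ⟨j', Or.inl (by rw [hcz, if_pos rfl]; omega)⟩
  -- the two shell values
  have hs1 : |ϑ (z, j)| ≤ Real.sqrt B := abs_theta_shell_le hB (Ne.symm hjj) hb1 (Or.inr (by rw [hcz, if_pos rfl]))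
  have hs2 : |ϑ (z + Pi.single j (1 : ℤ), j')| ≤ Real.sqrt B :=
    abs_theta_shell_le hB hjj hb2 (Or.inl (by rw [hcw, if_neg (fun h => hjj h), if_pos rfl]))
  -- the corner flux
  have hne3' : (z + Pi.single j' (1 : ℤ), j) ∉ dirFreeEdges H := by
    rw [hzj']; exact not_mem_dirFreeEdges_of_not_mem hne3
  have h := hB (z, j, j') (not_mem_dirFreeEdges_of_not_mem hne1) (not_mem_dirFreeEdges_of_not_mem hne2)
    hne3' (not_mem_dirFreeEdges_of_not_mem hne4)
  have hval : sCirc (LatticeMaxwell.glue (pin := fun e => e ∉ dirFreeEdges H) dirCorner (2 * H + 3) ϑ 0) (z, j, j') =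
      ϑ (z, j) + ϑ (z + Pi.single j (1 : ℤ), j') - ϑ (v, j) - ϑ (z, j') := by
    simp only [sCirc, hzj', dirGlue0_of_not_mem_coldBox ϑ hb1 hne1, dirGlue0_of_not_mem_coldBox ϑ hb2 hne2,
      dirGlue0_of_not_mem_coldBox ϑ hb3 hne3, dirGlue0_of_not_mem_coldBox ϑ hb4 hne4]
  rw [hval] at h
  have hflux := Real.abs_le_sqrt h
  have key : ϑ (v, j) + ϑ (z, j') =
      ϑ (z, j) + ϑ (z + Pi.single j (1 : ℤ), j') -
        (ϑ (z, j) + ϑ (z + Pi.single j (1 : ℤ), j') - ϑ (v, j) - ϑ (z, j')) := by ring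
  rw [key]
  refine (abs_sub _ _).trans ?_
  refine (add_le_add (abs_add_le _ _) le_rfl).trans ?_
  linarith

/-- **Two inward normals at a boundary vertex agree up to `3√B`**: for `v ∈ Λ` with `v_j = v_{j'} = 0` (`j ≠ j'`),
`|ϑ (v − e_j, j) − ϑ (v − e_{j'}, j')| ≤ 3√B` — the key `(v − e_j − e_{j'}, j, j')` is fully pinned. -/
theorem abs_theta_bot_sub_bot_le {v : Site 4} (hv : ∀ k, 0 ≤ v k ∧ v k ≤ 2 * (H : ℤ)) {j j' : Fin 4} (hjj : j ≠ j')
    (hj : v j = 0) (hj' : v j' = 0) :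
    |ϑ (v - Pi.single j (1 : ℤ), j) - ϑ (v - Pi.single j' (1 : ℤ), j')| ≤ 3 * Real.sqrt B := by
  set z : Site 4 := v - Pi.single j (1 : ℤ) - Pi.single j' (1 : ℤ) with hz
  have hcz : ∀ k, z k = if k = j then -1 else if k = j' then -1 else v k := fun k => by
    simp only [hz, Pi.sub_apply, Pi.single_apply]
    by_cases h1 : k = j <;> by_cases h2 : k = j' <;> simp [h1, h2, hj, hj'] <;> subst_vars <;> first | exact absurd rfl hjj | omega
  have hz1 : z + Pi.single j (1 : ℤ) = v - Pi.single j' (1 : ℤ) := by rw [hz]; abel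
  have hz2 : z + Pi.single j' (1 : ℤ) = v - Pi.single j (1 : ℤ) := by rw [hz]; abel
  have hc1 : ∀ k, (v - Pi.single j' (1 : ℤ) : Site 4) k = if k = j' then -1 else v k := fun k => by
    simp only [Pi.sub_apply, Pi.single_apply]; split_ifs with h <;> simp [h, hj']
  have hc2 : ∀ k, (v - Pi.single j (1 : ℤ) : Site 4) k = if k = j then -1 else v k := fun k => by
    simp only [Pi.sub_apply, Pi.single_apply]; split_ifs with h <;> simp [h, hj]
  -- edges of the key `(z, j, j')`
  have hb1 : (z, j) ∈ boxEdgesAt dirCorner (2 * H + 3) := by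
    refine mem_dirBlock_iff.2 ⟨fun k => ?_, ?_⟩
    · rw [hcz]; have := hv k; split_ifs <;> omega
    · rw [hcz, if_pos rfl]; omega
  have hne1 : (z, j) ∉ boxEdges 4 (2 * H + 1) := not_mem_boxEdges_of_fst ⟨j, Or.inl (by rw [hcz, if_pos rfl]; omega)⟩
  have hb2 : (v - Pi.single j' (1 : ℤ), j') ∈ boxEdgesAt dirCorner (2 * H + 3) := by
    refine mem_dirBlock_iff.2 ⟨fun k => ?_, ?_⟩
    · rw [hc1]; have := hv k; split_ifs <;> omega
    · rw [hc1, if_pos rfl]; omega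
  have hne2 : (v - Pi.single j' (1 : ℤ), j') ∉ boxEdges 4 (2 * H + 1) :=
    not_mem_boxEdges_of_fst ⟨j', Or.inl (by rw [hc1, if_pos rfl]; omega)⟩
  have hb3 : (v - Pi.single j (1 : ℤ), j) ∈ boxEdgesAt dirCorner (2 * H + 3) := by
    refine mem_dirBlock_iff.2 ⟨fun k => ?_, ?_⟩
    · rw [hc2]; have := hv k; split_ifs <;> omega
    · rw [hc2, if_pos rfl]; omega
  have hne3 : (v - Pi.single j (1 : ℤ), j) ∉ boxEdges 4 (2 * H + 1) :=
    not_mem_boxEdges_of_fst ⟨j, Or.inl (by rw [hc2, if_pos rfl]; omega)⟩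
  have hb4 : (z, j') ∈ boxEdgesAt dirCorner (2 * H + 3) := by
    refine mem_dirBlock_iff.2 ⟨fun k => ?_, ?_⟩
    · rw [hcz]; have := hv k; split_ifs <;> omega
    · rw [hcz, if_neg (fun h => hjj h.symm), if_pos rfl]; omega
  have hne4 : (z, j') ∉ boxEdges 4 (2 * H + 1) := not_mem_boxEdges_of_fst ⟨j, Or.inl (by rw [hcz, if_pos rfl]; omega)⟩
  -- the two shell values
  have hs1 : |ϑ (z, j)| ≤ Real.sqrt B :=
    abs_theta_shell_le hB (Ne.symm hjj) hb1 (Or.inr (by rw [hcz, if_neg (fun h => hjj h.symm), if_pos rfl]))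
  have hs4 : |ϑ (z, j')| ≤ Real.sqrt B := abs_theta_shell_le hB hjj hb4 (Or.inr (by rw [hcz, if_pos rfl]))
  -- the corner flux
  have hne2' : (z + Pi.single j (1 : ℤ), j') ∉ dirFreeEdges H := by
    rw [hz1]; exact not_mem_dirFreeEdges_of_not_mem hne2
  have hne3' : (z + Pi.single j' (1 : ℤ), j) ∉ dirFreeEdges H := by
    rw [hz2]; exact not_mem_dirFreeEdges_of_not_mem hne3
  have h := hB (z, j, j') (not_mem_dirFreeEdges_of_not_mem hne1) hne2' hne3' (not_mem_dirFreeEdges_of_not_mem hne4)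
  have hval : sCirc (LatticeMaxwell.glue (pin := fun e => e ∉ dirFreeEdges H) dirCorner (2 * H + 3) ϑ 0) (z, j, j') =
      ϑ (z, j) + ϑ (v - Pi.single j' (1 : ℤ), j') - ϑ (v - Pi.single j (1 : ℤ), j) - ϑ (z, j') := by
    simp only [sCirc, hz1, hz2, dirGlue0_of_not_mem_coldBox ϑ hb1 hne1, dirGlue0_of_not_mem_coldBox ϑ hb2 hne2,
      dirGlue0_of_not_mem_coldBox ϑ hb3 hne3, dirGlue0_of_not_mem_coldBox ϑ hb4 hne4]
  rw [hval] at h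
  have hflux := Real.abs_le_sqrt h
  have key : ϑ (v - Pi.single j (1 : ℤ), j) - ϑ (v - Pi.single j' (1 : ℤ), j') =
      ϑ (z, j) - ϑ (z, j') -
        (ϑ (z, j) + ϑ (v - Pi.single j' (1 : ℤ), j') - ϑ (v - Pi.single j (1 : ℤ), j) - ϑ (z, j')) := by ring
  rw [key]
  refine (abs_sub _ _).trans ?_
  refine (add_le_add (abs_sub _ _) le_rfl).trans ?_
  linarith

end Hyp

end Summit.QuantumFields.YangMills.Theorems.AllWindowsColdBoxBulkMidLine

end
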